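import Summits.ResolutionOfSingularities.ResolutionOfSingularities.Theorems.FrobeniusClosingPatchingRelPerfectDepthConeVertexCharts
import Literature.AlgebraicGeometry.Resolution.ExceptionalDivisorProjectiveBundle
import Literature.AlgebraicGeometry.Resolution.KollarFunctorLinearCentre
import HarnessLib

/-!
# [OURS · L1 W4.5(b) · EL♮(3) · door ν4, brick N-0 (JINIT at `RD := RPlus`), core `coreS`, piece (S-a)] THE `O`-POINT OF `ℙⁿ_R` WITH GIVEN
# HOMOGENEOUS COORDINATES — ★ `SectionOfVec.exists_section_of_vec`: a SECTION of `ℙⁿ_R → Spec R` killing every form that vanishes at the vector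

res-L1-w45b-nose-w1 g4 (WIDTH seat D-0157 DOOR 1; N-0 owner).  DEF-FREE; no `sorry`; standard axioms.  `--supports stmt-ResolutionOfSingularities-20148
--as helper`, counted 0.

WHAT.  The core `coreS` of ✓ `noseDatum_initial_of_sections` needs the node sections `𝔰 i : Spec O ⟶ ℙ³_O` THROUGH THE `O`-POINTS `[B̃ · nO i]` with
`𝓦₀ ≤ ker (𝔰 i)` EXACTLY (the nose model vanishes along the whole section).  Literature `ProjectiveSpace.vecChartPoint` is stated over a base FIELD; here is
the ring version, def-free: for `a : Fin (n+1) → R` with `a d = 1` the morphism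
`s := Spec R —(Spec ev_a)→ Spec (R[x]_{(x_d)})₀ = D₊(x_d) ↪ Proj R[x]`, `ev_a (F/x_d^m) = F(a)` (Mathlib `Localization.awayLift` through
`HomogeneousLocalization.Away → Localization.Away`), satisfies (S1) `s ≫ (toSpecZero ≫ Spec (algebraMap R R[x]₀)) = 𝟙` and (S2) `(F)~ ≤ ker s` for
every family of forms with `F_l(a) = 0` (chart pull-back ✓ `DepthCone.comap_awayι_projIdealSheaf_span` + Literature ✓ `comap_idealSheaf_specMap`,
✓ `affineBlowup.idealSheaf_eq_bot_iff`).  The identification of `s(𝔪_R)` with the `k`-point of coordinates `θ ∘ a` (S3) is NOT here.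
EL♮(3) is NOT proved; resolution of singularities in positive characteristic is NOT proved.
-/

set_option linter.dupNamespace false -- mandated namespace `Summit.<Summit>.<Problem>` of this single-conjunct summit

noncomputable section

open CategoryTheory AlgebraicGeometry TopologicalSpace
open MvPolynomial HomogeneousLocalization
open Literature.AlgebraicGeometry.Resolution Literature.RingTheory.GradedAlgebra
open AlgebraicGeometry.Scheme.IdealSheafData

namespace Summit.ResolutionOfSingularities.ResolutionOfSingularities.Cruxes.EquisingularLiftNat.Sections.Equinodal.SectionOfVec

universe u

variable {R : Type} [CommRing R] {n : ℕ}

/-- `x_d(a) = 1` is a unit. -/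
theorem isUnit_eval_X (a : Fin (n + 1) → R) (d : Fin (n + 1)) (ha : a d = 1) :
    IsUnit (MvPolynomial.eval a (X d : MvPolynomial (Fin (n + 1)) R)) := by
  rw [eval_X, ha]; exact isUnit_one

/-- **The evaluation `(R[x]_{(x_d)})₀ → R` at a vector with `a d = 1`** sends the dehomogenised form `F / x_d^m` to `F(a)`. [folklore] -/
theorem eval_mk₁ (a : Fin (n + 1) → R) (d : Fin (n + 1)) (ha : a d = 1) (m : ℕ) (F : MvPolynomial (Fin (n + 1)) R)
    (hF : F ∈ homogeneousSubmodule (Fin (n + 1)) R m) :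
    letI := MvPolynomial.gradedAlgebra (σ := Fin (n + 1)) (R := R)
    ((Localization.awayLift (MvPolynomial.eval a) (X d : MvPolynomial (Fin (n + 1)) R) (isUnit_eval_X a d ha)).comp
        (algebraMap (HomogeneousLocalization.Away (homogeneousSubmodule (Fin (n + 1)) R) (X d : MvPolynomial (Fin (n + 1)) R))
          (Localization.Away (X d : MvPolynomial (Fin (n + 1)) R))))
      (mk₁ (homogeneousSubmodule (Fin (n + 1)) R) (isHomogeneous_X R d) m F hF) = MvPolynomial.eval a F := by
  letI := MvPolynomial.gradedAlgebra (σ := Fin (n + 1)) (R := R)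
  rw [RingHom.comp_apply, HomogeneousLocalization.algebraMap_apply, val_mk₁]
  rw [Localization.awayLift_mk (MvPolynomial.eval a) (X d) F 1 (by rw [eval_X, ha, mul_one]) m]
  rw [one_pow, mul_one]

/-- ★ **(S1) THE EXPLICIT `O`-POINT `[a] : Spec R ⟶ Proj R[x₀..xₙ]` (`a d = 1`, built through `D₊(x_d)` by evaluation) IS A SECTION of
`ℙⁿ_R → Spec R`.** [cite: Hartshorne1977, II Thm. 7.1] [OURS · core `coreS`, piece (S-a)] -/
theorem sectionOfVec_comp_eq_id (a : Fin (n + 1) → R) (d : Fin (n + 1)) (ha : a d = 1) :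
    letI := MvPolynomial.gradedAlgebra (σ := Fin (n + 1)) (R := R)
    (Spec.map (CommRingCat.ofHom ((Localization.awayLift (MvPolynomial.eval a) (X d : MvPolynomial (Fin (n + 1)) R) (isUnit_eval_X a d ha)).comp
        (algebraMap (HomogeneousLocalization.Away (homogeneousSubmodule (Fin (n + 1)) R) (X d : MvPolynomial (Fin (n + 1)) R))
          (Localization.Away (X d : MvPolynomial (Fin (n + 1)) R))))) ≫
      Proj.awayι (homogeneousSubmodule (Fin (n + 1)) R) (X d) (isHomogeneous_X R d) one_pos) ≫
      (Proj.toSpecZero (homogeneousSubmodule (Fin (n + 1)) R) ≫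
        Spec.map (CommRingCat.ofHom (algebraMap R ((homogeneousSubmodule (Fin (n + 1)) R) 0)))) = 𝟙 _ := by
  letI := MvPolynomial.gradedAlgebra (σ := Fin (n + 1)) (R := R)
  set ev : HomogeneousLocalization.Away (homogeneousSubmodule (Fin (n + 1)) R) (X d : MvPolynomial (Fin (n + 1)) R) →+* R :=
    (Localization.awayLift (MvPolynomial.eval a) (X d : MvPolynomial (Fin (n + 1)) R) (isUnit_eval_X a d ha)).comp
      (algebraMap (HomogeneousLocalization.Away (homogeneousSubmodule (Fin (n + 1)) R) (X d : MvPolynomial (Fin (n + 1)) R))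
        (Localization.Away (X d : MvPolynomial (Fin (n + 1)) R))) with hev
  -- `ev ∘ fromZero ∘ algebraMap = id`
  have hring : ev.comp ((HomogeneousLocalization.fromZeroRingHom (homogeneousSubmodule (Fin (n + 1)) R) _).comp
      (algebraMap R ((homogeneousSubmodule (Fin (n + 1)) R) 0))) = RingHom.id R := by
    ext c
    simp only [RingHom.comp_apply, RingHom.id_apply, hev, HomogeneousLocalization.algebraMap_apply]
    have hval : (HomogeneousLocalization.fromZeroRingHom (homogeneousSubmodule (Fin (n + 1)) R) (Submonoid.powers (X d))
        (algebraMap R ((homogeneousSubmodule (Fin (n + 1)) R) 0) c)).val =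
        algebraMap (MvPolynomial (Fin (n + 1)) R) (Localization.Away (X d : MvPolynomial (Fin (n + 1)) R)) (C c) := by
      rw [HomogeneousLocalization.fromZeroRingHom]
      simp only [RingHom.coe_mk, MonoidHom.coe_mk, OneHom.coe_mk, HomogeneousLocalization.val_mk]
      rw [Localization.mk_eq_mk', IsLocalization.mk'_eq_iff_eq_mul]
      simp [MvPolynomial.algebraMap_eq]
    rw [hval]
    change IsLocalization.Away.lift (X d : MvPolynomial (Fin (n + 1)) R) (isUnit_eval_X a d ha) _ = c
    rw [IsLocalization.Away.lift_eq, eval_C]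
  rw [Category.assoc, Proj.awayι_toSpecZero_assoc, ← Spec.map_comp, ← Spec.map_comp, ← CommRingCat.ofHom_comp, ← CommRingCat.ofHom_comp,
    hring, CommRingCat.ofHom_id, Spec.map_id]

/-- ★ **(S2) FORMS VANISHING AT `a` VANISH ALONG THE `O`-POINT `[a]`**: `(F)~ ≤ ker [a]` for every finite family of forms `F_l` of degrees `N_l`
with `F_l(a) = 0` (chart pull-back of `(F)~` = the ideal sheaf of the dehomogenised forms, killed by evaluation at `a`).
[cite: Hartshorne1977, II Prop. 5.9] [OURS · core `coreS`, piece (S-a)] -/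
theorem projIdealSheaf_le_ker_sectionOfVec (a : Fin (n + 1) → R) (d : Fin (n + 1)) (ha : a d = 1) {c : ℕ}
    (F : Fin c → MvPolynomial (Fin (n + 1)) R) (N : Fin c → ℕ) (hF : ∀ l, F l ∈ homogeneousSubmodule (Fin (n + 1)) R (N l))
    (hFa : ∀ l, MvPolynomial.eval a (F l) = 0) :
    letI := MvPolynomial.gradedAlgebra (σ := Fin (n + 1)) (R := R)
    projIdealSheaf (homogeneousSubmodule (Fin (n + 1)) R) ⟨Ideal.span (Set.range F), isHomogeneous_span_of_forall_mem _ F N hF⟩ ≤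
      Scheme.Hom.ker (Spec.map (CommRingCat.ofHom ((Localization.awayLift (MvPolynomial.eval a) (X d : MvPolynomial (Fin (n + 1)) R) (isUnit_eval_X a d ha)).comp
        (algebraMap (HomogeneousLocalization.Away (homogeneousSubmodule (Fin (n + 1)) R) (X d : MvPolynomial (Fin (n + 1)) R))
          (Localization.Away (X d : MvPolynomial (Fin (n + 1)) R))))) ≫
      Proj.awayι (homogeneousSubmodule (Fin (n + 1)) R) (X d) (isHomogeneous_X R d) one_pos) := by
  letI := MvPolynomial.gradedAlgebra (σ := Fin (n + 1)) (R := R)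
  rw [← Scheme.IdealSheafData.map_bot, Scheme.IdealSheafData.le_map_iff_comap_le, le_bot_iff, Scheme.IdealSheafData.comap_comp,
    Summit.ResolutionOfSingularities.ResolutionOfSingularities.Theorems.DepthCone.comap_awayι_projIdealSheaf_span _ F N hF (isHomogeneous_X R d),
    comap_idealSheaf_specMap, affineBlowup.idealSheaf_eq_bot_iff, Ideal.map_span, ← Set.range_comp, Ideal.span_eq_bot]
  rintro _ ⟨l, rfl⟩
  change ((Localization.awayLift (MvPolynomial.eval a) (X d : MvPolynomial (Fin (n + 1)) R) (isUnit_eval_X a d ha)).comp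
    (algebraMap (HomogeneousLocalization.Away (homogeneousSubmodule (Fin (n + 1)) R) (X d : MvPolynomial (Fin (n + 1)) R))
      (Localization.Away (X d : MvPolynomial (Fin (n + 1)) R))))
    (mk₁ (homogeneousSubmodule (Fin (n + 1)) R) (isHomogeneous_X R d) (N l) (F l) (hF l)) = 0
  rw [eval_mk₁ a d ha, hFa]


/-- ★ **(S-dict) THE SUPPORT DICTIONARY OF THE `O`-POINT**: for `R` local, the closed point of `Spec R` is carried by `[a]` INTO the support of
`(F)~` iff every `F_l(a)` lies in the maximal ideal (chart pull-back = the ideal sheaf of `(F_l(a))_l` on `Spec R`, whose support is its zero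
locus). [cite: Hartshorne1977, II Prop. 5.9] [OURS · core `coreS`, piece (S-a)] -/
theorem sectionOfVec_closedPoint_mem_support_iff [IsLocalRing R] (a : Fin (n + 1) → R) (d : Fin (n + 1)) (ha : a d = 1) {c : ℕ}
    (F : Fin c → MvPolynomial (Fin (n + 1)) R) (N : Fin c → ℕ) (hF : ∀ l, F l ∈ homogeneousSubmodule (Fin (n + 1)) R (N l)) :
    letI := MvPolynomial.gradedAlgebra (σ := Fin (n + 1)) (R := R)
    (Spec.map (CommRingCat.ofHom ((Localization.awayLift (MvPolynomial.eval a) (X d : MvPolynomial (Fin (n + 1)) R) (isUnit_eval_X a d ha)).comp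
        (algebraMap (HomogeneousLocalization.Away (homogeneousSubmodule (Fin (n + 1)) R) (X d : MvPolynomial (Fin (n + 1)) R))
          (Localization.Away (X d : MvPolynomial (Fin (n + 1)) R))))) ≫
      Proj.awayι (homogeneousSubmodule (Fin (n + 1)) R) (X d) (isHomogeneous_X R d) one_pos) (IsLocalRing.closedPoint R) ∈
        ((projIdealSheaf (homogeneousSubmodule (Fin (n + 1)) R) ⟨Ideal.span (Set.range F), isHomogeneous_span_of_forall_mem _ F N hF⟩).support :
          Set (Proj (homogeneousSubmodule (Fin (n + 1)) R))) ↔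
      ∀ l, MvPolynomial.eval a (F l) ∈ IsLocalRing.maximalIdeal R := by
  letI := MvPolynomial.gradedAlgebra (σ := Fin (n + 1)) (R := R)
  set K := projIdealSheaf (homogeneousSubmodule (Fin (n + 1)) R) ⟨Ideal.span (Set.range F), isHomogeneous_span_of_forall_mem _ F N hF⟩ with hK
  have hcomap : K.comap (Spec.map (CommRingCat.ofHom ((Localization.awayLift (MvPolynomial.eval a) (X d : MvPolynomial (Fin (n + 1)) R) (isUnit_eval_X a d ha)).comp
        (algebraMap (HomogeneousLocalization.Away (homogeneousSubmodule (Fin (n + 1)) R) (X d : MvPolynomial (Fin (n + 1)) R))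
          (Localization.Away (X d : MvPolynomial (Fin (n + 1)) R))))) ≫
      Proj.awayι (homogeneousSubmodule (Fin (n + 1)) R) (X d) (isHomogeneous_X R d) one_pos) =
      affineBlowup.idealSheaf (Ideal.span (Set.range fun l => MvPolynomial.eval a (F l))) := by
    rw [hK, Scheme.IdealSheafData.comap_comp,
      Summit.ResolutionOfSingularities.ResolutionOfSingularities.Theorems.DepthCone.comap_awayι_projIdealSheaf_span _ F N hF (isHomogeneous_X R d),
      comap_idealSheaf_specMap, Ideal.map_span, ← Set.range_comp]
    exact congrArg (fun t : Fin c → R => affineBlowup.idealSheaf (Ideal.span (Set.range t)))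
      (funext fun l => eval_mk₁ a d ha (N l) (F l) (hF l))
  have hmem : IsLocalRing.closedPoint R ∈ ((K.comap (Spec.map (CommRingCat.ofHom ((Localization.awayLift (MvPolynomial.eval a) (X d : MvPolynomial (Fin (n + 1)) R) (isUnit_eval_X a d ha)).comp
        (algebraMap (HomogeneousLocalization.Away (homogeneousSubmodule (Fin (n + 1)) R) (X d : MvPolynomial (Fin (n + 1)) R))
          (Localization.Away (X d : MvPolynomial (Fin (n + 1)) R))))) ≫
      Proj.awayι (homogeneousSubmodule (Fin (n + 1)) R) (X d) (isHomogeneous_X R d) one_pos)).support : Set (Spec (.of R))) ↔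
      ∀ l, MvPolynomial.eval a (F l) ∈ IsLocalRing.maximalIdeal R := by
    rw [hcomap, affineBlowup.support_idealSheaf]
    change ((Ideal.span (Set.range fun l => MvPolynomial.eval a (F l)) : Ideal R) : Set R) ⊆ (IsLocalRing.maximalIdeal R : Set R) ↔ _
    rw [SetLike.coe_subset_coe, Ideal.span_le, Set.range_subset_iff]
    rfl
  rw [← hmem, Scheme.IdealSheafData.support_comap]
  rfl

/-- ★ **THE SECTION OF `ℙⁿ_R → Spec R` WITH HOMOGENEOUS COORDINATES `a` (`a d = 1`)**, packaged: there is `s : Spec R ⟶ Proj R[x₀..xₙ]` (the explicit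
`[a]` above) with (S1) `s ≫ (toSpecZero ≫ Spec (algebraMap R R[x]₀)) = 𝟙` and (S2) `(F)~ ≤ ker s` for every finite family of forms `F_l` of degrees
`N_l` with `F_l(a) = 0`. [cite: Hartshorne1977, II Thm. 7.1] [OURS · core `coreS`, piece (S-a)] -/
theorem exists_section_of_vec (a : Fin (n + 1) → R) (d : Fin (n + 1)) (ha : a d = 1) :
    letI := MvPolynomial.gradedAlgebra (σ := Fin (n + 1)) (R := R)
    ∃ s : Spec (.of R) ⟶ Proj (homogeneousSubmodule (Fin (n + 1)) R),
      s = (Spec.map (CommRingCat.ofHom ((Localization.awayLift (MvPolynomial.eval a) (X d : MvPolynomial (Fin (n + 1)) R) (isUnit_eval_X a d ha)).comp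
        (algebraMap (HomogeneousLocalization.Away (homogeneousSubmodule (Fin (n + 1)) R) (X d : MvPolynomial (Fin (n + 1)) R))
          (Localization.Away (X d : MvPolynomial (Fin (n + 1)) R))))) ≫
      Proj.awayι (homogeneousSubmodule (Fin (n + 1)) R) (X d) (isHomogeneous_X R d) one_pos) ∧
      s ≫ (Proj.toSpecZero (homogeneousSubmodule (Fin (n + 1)) R) ≫
        Spec.map (CommRingCat.ofHom (algebraMap R ((homogeneousSubmodule (Fin (n + 1)) R) 0)))) = 𝟙 _ ∧
      ∀ {c : ℕ} (F : Fin c → MvPolynomial (Fin (n + 1)) R) (N : Fin c → ℕ)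
        (hF : ∀ l, F l ∈ homogeneousSubmodule (Fin (n + 1)) R (N l)), (∀ l, MvPolynomial.eval a (F l) = 0) →
        projIdealSheaf (homogeneousSubmodule (Fin (n + 1)) R) ⟨Ideal.span (Set.range F), isHomogeneous_span_of_forall_mem _ F N hF⟩ ≤ s.ker :=
  letI := MvPolynomial.gradedAlgebra (σ := Fin (n + 1)) (R := R)
  ⟨_, rfl, sectionOfVec_comp_eq_id a d ha, fun F N hF hFa => projIdealSheaf_le_ker_sectionOfVec a d ha F N hF hFa⟩

end Summit.ResolutionOfSingularities.ResolutionOfSingularities.Cruxes.EquisingularLiftNat.Sections.Equinodal.SectionOfVec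

end
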